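import Literature.AnabelianGeometry.EtaleTheta.KummerDataOfCoreSection
import Literature.AnabelianGeometry.EtaleTheta.ConstantMultipleRigidityEquivarianceProofs
import Literature.AnabelianGeometry.EtaleTheta.BarDeltaOfSetting
import Literature.AnabelianGeometry.EtaleTheta.ContH1Lemmas
import HarnessLib

/-!
# [EtTh] Prop. 1.5 (ii), clause «`F̈² = H¹(G_K̈, Δ_Θ)`», HOLDS at every section Kummer datum
# (inflation–restriction for the split extension; K2 ↔ R78, abc-iut-w5-d140)

S. Mochizuki, *The étale theta function …*, Publ. RIMS 45 (2009), §1, Prop. 1.5 (ii) p.249: "`F̈² =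
H¹(G_K̈, Δ_Θ) →̃ (K̈^×)^∧`" [cite: MochizukiEtTh2009, Prop 1.5 (ii) p.23]; the underlying cohomology is the
inflation–restriction sequence [cite: NeukirchSchmidtWingberg2008, I §6 Prop 1.6.7].  PROOF-ONLY sequel of
abc-iut-L2-t6's `KummerDataOfCoreSection.lean` (p430358: `KummerCore.toKummerDataOfSection`, `kumOfSection`,
`kumOfSection_mk`) over abc-iut-w5-d171's `KummerDataOfCore.lean`.  K2 holder abc-iut-w5-d140 (the K2 routes
consume `Prop15ii` BY NAME; this is the one of its three fields every K2 route and V2′ actually use).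

For a Kummer core `C` and a Galois section `s` (the data of p430358), the third field `Fdd2_eq` of
abc-iut-L2-t1's `Prop15ii` holds for `E := C.toKummerDataOfSection s …`:
  `F̈² := Ker(H¹((Π^tp_Ÿ)^Θ, Δ_Θ) → H¹((Δ^tp_Ÿ)^Θ, Δ_Θ)) = range κ̈`.
(⊇) a class pulled back along `augTheta` is represented by a cocycle CONSTANT `= 1` on
`N := (Δ^tp_Ÿ)^Θ ⊆ Ker augTheta`; (⊆) if `x|_N` is a coboundary then, `N` centralising `Δ_Θ`
(`deltaTheta_comm_dtpTheta`), a representing cocycle `f` VANISHES on `N`, so `f(h) = f(t·n) = f(t)` with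
`t := toTheta(s(augTheta h))`, `n := t⁻¹h ∈ N` — i.e. `f = (f ∘ toTheta ∘ s) ∘ augTheta` on the nose and
`x = κ̈(s^* x)`.  The other two fields of `Prop15ii` (`log(Ü) ∈ F̈¹`, `res_{Δ_Θ}` surjective) are statements
about `log(Ü)` and the theta class and stay model-level.  HONEST FRAMING: generic in `(C, s)`; nothing of
[EtTh] is asserted; no side taken on [IUTchIII] Cor. 3.12.
-/

noncomputable section

namespace Literature.AnabelianGeometry.EtaleTheta

open Literature.AnabelianGeometry.SemiGraphs
open scoped IsMulCommutative

namespace ThetaSetting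

namespace KummerCore

variable {p : ℕ} [Fact p.Prime] {D : ThetaSetting p} (C : D.KummerCore)
  (s : GQp p →* D.PiTemp) (hs : Continuous s) (hsec : ∀ σ : GQp p, D.aug (s σ) = σ)
  (hsY : D.GK.map s ≤ D.GtpY) (hsYdd : D.GKdd.map s ≤ D.GtpYdd)

/-- `(Δ^tp_Ÿ)^Θ ≤ (Δ^tp_X)^Θ` (so it centralises `Δ_Θ`). [cite: MochizukiEtTh2009, §1 p.12] -/
theorem map_dtpYdd_le_dtpTheta : (D.DtpYddN 1).map D.toTheta ≤ D.DtpTheta :=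
  Subgroup.map_mono inf_le_right

/-- `augTheta` kills `(Δ^tp_Ÿ)^Θ` (`augTheta ∘ toTheta = aug`, `Δ = Ker aug`). [cite: MochizukiEtTh2009, §1 p.12] -/
theorem augTheta_eq_one_of_mem_map_dtpYdd {n : D.GtpTheta} (hn : n ∈ (D.DtpYddN 1).map D.toTheta) :
    C.augTheta n = 1 := by
  obtain ⟨g, hg, rfl⟩ := hn
  rw [C.augTheta_toTheta]
  exact (Subgroup.mem_inf.mp hg).2

include hsec hsYdd in
/-- For `h ∈ (Π^tp_Ÿ)^Θ`, the correction `(toTheta (s (augTheta h)))⁻¹ · h` lies in `(Δ^tp_Ÿ)^Θ`.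
[cite: MochizukiEtTh2009, §1 p.12] -/
theorem section_correction_mem {h : D.GtpTheta} (hh : h ∈ D.GtpYdd.map D.toTheta) :
    (D.toTheta (s (C.augTheta h)))⁻¹ * h ∈ (D.DtpYddN 1).map D.toTheta := by
  obtain ⟨g, hg, rfl⟩ := hh
  have hsg : s (C.augTheta (D.toTheta g)) ∈ D.GtpYdd := by
    refine hsYdd ⟨C.augTheta (D.toTheta g), ?_, rfl⟩
    have : C.augTheta (D.toTheta g) ∈ (D.GtpYdd.map D.toTheta).map C.augTheta := ⟨_, ⟨g, hg, rfl⟩, rfl⟩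
    rw [C.map_augTheta_gtpYdd] at this
    exact this
  refine ⟨(s (C.augTheta (D.toTheta g)))⁻¹ * g, Subgroup.mem_inf.mpr ⟨?_, ?_⟩, by rw [map_mul, map_inv]⟩
  · exact D.GtpYdd.mul_mem (D.GtpYdd.inv_mem hsg) hg
  · change D.aug.toMonoidHom ((s (C.augTheta (D.toTheta g)))⁻¹ * g) = 1
    rw [map_mul, map_inv]
    change (D.aug (s (C.augTheta (D.toTheta g))))⁻¹ * D.aug g = 1
    rw [hsec, C.augTheta_toTheta, inv_mul_cancel]

/-- A class of `H¹((Π^tp_Ÿ)^Θ, Δ_Θ)` dying on `(Δ^tp_Ÿ)^Θ` is represented by a cocycle VANISHING there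
(`(Δ^tp_Ÿ)^Θ` centralises `Δ_Θ`, so its coboundaries are trivial). [cite: NeukirchSchmidtWingberg2008, I §6 Prop 1.6.7] -/
theorem cocycle_eq_one_of_mem_Fdd2 (f : contCocycles (MonoidHom.id D.GtpTheta) D.DeltaTheta (D.GtpYdd.map D.toTheta))
    (hf : (QuotientGroup.mk f : D.H1Theta (D.GtpYdd.map D.toTheta)) ∈
      (Fdd2 : Subgroup (D.H1Theta (D.GtpYdd.map D.toTheta))))
    {n : D.GtpTheta} (hn : n ∈ (D.DtpYddN 1).map D.toTheta) :
    f.1 ⟨n, D.map_toTheta_DtpYddN_one_le hn⟩ = 1 := by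
  have h1 : (QuotientGroup.mk (ContH1.resCocycle (MonoidHom.id D.GtpTheta) D.DeltaTheta
      (D.map_toTheta_DtpYddN_one_le) f) : D.H1Theta ((D.DtpYddN 1).map D.toTheta)) = 1 := hf
  rw [QuotientGroup.eq_one_iff, Subgroup.mem_subgroupOf, mem_contCoboundaries_iff] at h1
  obtain ⟨a, ha⟩ := h1
  have h2 := congrFun ha ⟨n, hn⟩
  change f.1 ⟨n, D.map_toTheta_DtpYddN_one_le hn⟩ = _ at h2
  rw [h2]
  have hcomm : MulAut.conjNormal ((MonoidHom.id D.GtpTheta) ((⟨n, hn⟩ : (D.DtpYddN 1).map D.toTheta) :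
      D.GtpTheta)) a = a := Subtype.ext (by
    rw [MulAut.conjNormal_apply, MonoidHom.id_apply,
      ← D.deltaTheta_comm_dtpTheta a.2 (map_dtpYdd_le_dtpTheta hn), mul_inv_cancel_right])
  rw [hcomm, mul_inv_cancel]

include hsec in
/-- **`F̈² = range κ̈` at the section datum** (the field `Prop15ii.Fdd2_eq` for
`C.toKummerDataOfSection s …`): inflation–restriction for the split extension
`(Π^tp_Ÿ)^Θ = (Δ^tp_Ÿ)^Θ ⋊ s(G_K̈)` with `(Δ^tp_Ÿ)^Θ` acting trivially on `Δ_Θ`.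
[cite: MochizukiEtTh2009, Prop 1.5 (ii) p.23] -/
theorem Fdd2_eq_range_kumYdd_of_section :
    (Fdd2 : Subgroup (D.H1Theta (D.GtpYdd.map D.toTheta))) =
      (C.toKummerDataOfSection s hs hsec hsY hsYdd).kumYdd.range := by
  ext x
  constructor
  · -- (⊆): a class dying on `(Δ^tp_Ÿ)^Θ` is the Kummer class of its pull-back along the section
    intro hx
    refine ⟨ContH1.comap D.toTheta D.DeltaTheta s hs hsYdd (D.inflTheta D.GtpYdd x), ?_⟩
    rw [toKummerDataOfSection_kumYdd]
    induction x using QuotientGroup.induction_on with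
    | H f =>
      change ContH1.mk _ _ = ContH1.mk _ _
      refine ContH1.mk_congr _ (funext fun h => ?_) _ _
      change f.1 ⟨D.toTheta (s (C.augTheta h.1)), _⟩ = f.1 h
      -- `h = t · n` with `t := toTheta (s (augTheta h))`, `n ∈ (Δ^tp_Ÿ)^Θ`, and `f(n) = 1`
      have hn := C.section_correction_mem s hsec hsYdd h.2
      have ht : D.toTheta (s (C.augTheta h.1)) ∈ D.GtpYdd.map D.toTheta := by
        have := (D.GtpYdd.map D.toTheta).mul_mem h.2 ((D.GtpYdd.map D.toTheta).inv_mem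
          (D.map_toTheta_DtpYddN_one_le hn))
        simpa using this
      have hdecomp : h = (⟨D.toTheta (s (C.augTheta h.1)), ht⟩ : D.GtpYdd.map D.toTheta) *
          ⟨(D.toTheta (s (C.augTheta h.1)))⁻¹ * h.1, D.map_toTheta_DtpYddN_one_le hn⟩ :=
        Subtype.ext (by simp)
      conv_rhs => rw [hdecomp, f.2.2]
      rw [cocycle_eq_one_of_mem_Fdd2 f hx hn, map_one, mul_one]
  · -- (⊇): a pulled-back class is represented by a cocycle constant `= 1` on `(Δ^tp_Ÿ)^Θ ⊆ Ker augTheta`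
    rintro ⟨c, rfl⟩
    rw [toKummerDataOfSection_kumYdd]
    induction c using QuotientGroup.induction_on with
    | H g =>
      change ContH1.res (MonoidHom.id D.GtpTheta) D.DeltaTheta D.map_toTheta_DtpYddN_one_le
        (C.kumOfSection s hsec (D.GtpYdd.map D.toTheta) D.GKdd C.map_augTheta_gtpYdd.le
          (ContH1.mk g.1 g.2)) = 1
      rw [C.kumOfSection_mk]
      change ContH1.mk _ _ = (1 : D.H1Theta ((D.DtpYddN 1).map D.toTheta))
      have h1 : (1 : D.H1Theta ((D.DtpYddN 1).map D.toTheta)) =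
          ContH1.mk (fun _ => 1) (one_mem _) := rfl
      rw [h1]
      refine ContH1.mk_congr _ (funext fun n => ?_) _ _
      change g.1 ⟨C.augTheta n.1, _⟩ = 1
      have hone : (⟨C.augTheta n.1, C.map_augTheta_gtpYdd.le ⟨n.1, D.map_toTheta_DtpYddN_one_le n.2, rfl⟩⟩ :
          D.GKdd) = 1 := Subtype.ext (C.augTheta_eq_one_of_mem_map_dtpYdd n.2)
      rw [hone]
      exact ContH1.cocycle_map_one g

include hsec in
/-- **Prop. 1.5 (ii) at the section datum from its two MODEL-LEVEL clauses**: given the restriction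
`H¹((Π^tp_Ÿ)^Θ, Δ_Θ) → Hom(Δ_Θ, Δ_Θ)` surjective and `log(Ü) ∈ F̈¹` (statements about the theta class and the
coordinate class of the model), the section datum satisfies abc-iut-L2-t1's `Prop15ii` — the clause `F̈² = Im κ̈`
being generic (`Fdd2_eq_range_kumYdd_of_section`).  The R78 to-do for Prop. 1.5 (ii) is exactly these two
clauses. [cite: MochizukiEtTh2009, Prop 1.5 (ii) p.23] -/
theorem prop15ii_of_section (hC : D.Compat)
    (hsurj : Function.Surjective
      (ContH1.res (MonoidHom.id D.GtpTheta) D.DeltaTheta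
        (hC.deltaTheta_le_DtpYddTheta.trans (Subgroup.map_mono inf_le_left)) :
        D.H1Theta (D.GtpYdd.map D.toTheta) → D.H1Theta D.DeltaTheta))
    (hlog : C.logUdd ∈ Fdd1 hC) :
    Prop15ii (C.toKummerDataOfSection s hs hsec hsY hsYdd) hC :=
  ⟨hsurj, hlog, C.Fdd2_eq_range_kumYdd_of_section s hs hsec hsY hsYdd⟩

end KummerCore

end ThetaSetting

end Literature.AnabelianGeometry.EtaleTheta

end
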